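import Mathlib
import Summits.ValiantsHypothesis.ValiantsHypothesis.Theorems.GeneratorObstructionsPerGenDegreeSuperQPPaddedTableauDefs
import Summits.ValiantsHypothesis.ValiantsHypothesis.Theorems.GeneratorObstructionsPowGenDegreeQPGadgetTableauFrame

/-!
# Route GeneratorObstructions — crux K1 `PerGenDegreeSuperQP` (stmt-ValiantsHypothesis-11654), line
# `per-side-atoms`: box count of the padded gadget tableau

Companion of `…PerGenDegreeSuperQPPaddedTableauDefs` (`paddedTab`, `padHeight`, `padBox`).  The cardinality
half of the frame (bijectivity of the box map, model `…PowGenDegreeQPGadgetTableauFrame`): the diagram of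
`paddedTab c` has exactly `d · m = 6(2^c - 1) · (5c + 1)` boxes (`sum_padHeight`).  The tall part is counted
against the crux-K2 gadget tableau `gadgetTab 1 (c+1)` (`sum_depth`): a tall column of `paddedTab c` is the
corresponding column of `gadgetTab 1 (c+1)` with its (at most three) block-`0` boxes removed and the `z`-box
added (`padHeight_add_depth`).

Honest framing: index arithmetic; no stub, crux or summit is settled here; `VP ≠ VNP` untouched. [folklore]
-/

namespace Summit.ValiantsHypothesis.ValiantsHypothesis.Theorems.GeneratorObstructions.PerGenDegreeSuperQP

open Summit.ValiantsHypothesis.ValiantsHypothesis.Theorems.GeneratorObstructions.PowGenDegreeQP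

-- `Summit.ValiantsHypothesis.ValiantsHypothesis.…` is the tree's mandated single-conjunct layout.
set_option linter.dupNamespace false

noncomputable section

/-- Height plus depth of a tall column: `padHeight + depth + correction = 3c + 4`, where `depth` is the
depth of the same column in `gadgetTab 1 (c+1)` (summand of `sum_depth 1`) and the correction `3, 2, 0`
accounts for the deleted block-`0` boxes of the columns `q = 0`, `q = 1`, `q ≥ 2`. [folklore] -/
theorem padHeight_add_depth (c n : ℕ) (hn : n < padTall c) :
    padHeight c n + (if n < 3 * 1 then 0 else 3 * Nat.log 2 (n / (3 * 1)) + 1) +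
      (if n < 3 then 3 else if n < 6 then 2 else 0) = 3 * c + 4 := by
  have h31 : n / (3 * 1) = n / 3 := by norm_num
  rw [h31]
  unfold padHeight
  rw [if_pos hn]
  by_cases h3 : n < 3
  · have hq : n / 3 < 2 := by rw [Nat.div_lt_iff_lt_mul (by norm_num)]; omega
    rw [if_pos hq, if_pos (by omega : n < 3 * 1), if_pos h3]
  · rw [if_neg (by omega : ¬ n < 3 * 1), if_neg h3]
    by_cases h6 : n < 6
    · have hq : n / 3 < 2 := by rw [Nat.div_lt_iff_lt_mul (by norm_num)]; omega
      have hq1 : n / 3 = 1 := by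
        have : 1 ≤ n / 3 := (Nat.le_div_iff_mul_le (by norm_num)).mpr (by omega)
        omega
      rw [if_pos hq, if_pos h6, hq1, Nat.log_one_right]
    · have hq : ¬ n / 3 < 2 := by
        rw [not_lt, Nat.le_div_iff_mul_le (by norm_num)]; omega
      rw [if_neg hq, if_neg h6]
      have hq' : n / 3 < 2 ^ (c + 1) := by
        rw [Nat.div_lt_iff_lt_mul (by norm_num)]; unfold padTall at hn; omega
      have hlog : Nat.log 2 (n / 3) < c + 1 :=
        (Nat.log_lt_iff_lt_pow (by norm_num) (by omega)).mpr hq'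
      omega

/-- The correction terms sum to `15`. [folklore] -/
theorem sum_correction {N : ℕ} (hN : 6 ≤ N) :
    ∑ n ∈ Finset.range N, (if n < 3 then 3 else if n < 6 then 2 else 0) = 15 := by
  obtain ⟨R, rfl⟩ := Nat.exists_eq_add_of_le hN
  rw [Finset.sum_range_add, Finset.sum_eq_zero (s := Finset.range R) fun n _ => by
    rw [if_neg (by omega), if_neg (by omega)]]
  decide

/-- **The tall part has `36·2^c - 30` boxes** (`6·2^c` tops and `5d = 30·2^c - 30` gadget boxes).
[folklore] -/
theorem sum_padHeight_tall {c : ℕ} (hc : 2 ≤ c) :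
    ∑ n ∈ Finset.range (padTall c), padHeight c n + 30 = 36 * 2 ^ c := by
  obtain ⟨h4, hD, hT, hD1, hDed, hE4⟩ := pad_sizes hc
  have hdepth := sum_depth 1 le_rfl (c + 1)
  have hT' : 3 * 1 * 2 ^ (c + 1) = padTall c := by rw [hT, pow_succ]; ring
  rw [hT'] at hdepth
  have hsum : ∑ n ∈ Finset.range (padTall c), (padHeight c n +
      (if n < 3 * 1 then 0 else 3 * Nat.log 2 (n / (3 * 1)) + 1) +
      (if n < 3 then 3 else if n < 6 then 2 else 0)) = padTall c * (3 * c + 4) := by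
    rw [Finset.sum_congr rfl fun n hn => padHeight_add_depth c n (Finset.mem_range.mp hn),
      Finset.sum_const, Finset.card_range, smul_eq_mul]
  rw [Finset.sum_add_distrib, Finset.sum_add_distrib, sum_correction (by omega)] at hsum
  rw [hT] at hsum hdepth ⊢
  have hX : 2 ^ (c + 1) = 2 * 2 ^ c := by rw [pow_succ]; ring
  rw [hX] at hdepth
  set S := ∑ n ∈ Finset.range (6 * 2 ^ c), padHeight c n
  set P := ∑ n ∈ Finset.range (6 * 2 ^ c),
    (if n < 3 * 1 then 0 else 3 * Nat.log 2 (n / (3 * 1)) + 1)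
  set X := 2 ^ c
  have h1 : S + P + 15 = 18 * (c * X) + 24 * X := by rw [hsum]; ring
  have h2 : P + 30 * X = 18 * (c * X) + 18 * X + 15 := by linarith [hdepth]
  omega

/-- **The diagram of `paddedTab c` has `d · m = 6(2^c-1)(5c+1)` boxes.** [folklore] -/
theorem sum_padHeight {c : ℕ} (hc : 2 ≤ c) :
    ∑ n ∈ Finset.range (padC c), padHeight c n = padD c * (5 * c + 1) := by
  obtain ⟨h4, hD, hT, hD1, hDed, hE4⟩ := pad_sizes hc
  have htall := sum_padHeight_tall hc
  have hC : padC c = padTall c + (padD c * padE4 c + padDed c) := by unfold padC; ring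
  rw [hC, Finset.sum_range_add]
  have hrest : ∑ x ∈ Finset.range (padD c * padE4 c + padDed c), padHeight c (padTall c + x) =
      padD c * padE4 c + padDed c := by
    have hone : ∀ x ∈ Finset.range (padD c * padE4 c + padDed c), padHeight c (padTall c + x) = 1 := by
      intro x _
      unfold padHeight
      rw [if_neg (Nat.not_lt.mpr (Nat.le_add_right _ _))]
    rw [Finset.sum_congr rfl hone, Finset.sum_const, Finset.card_range, smul_eq_mul, mul_one]
  rw [hrest]
  set S := ∑ n ∈ Finset.range (padTall c), padHeight c n
  -- arithmetic: `S = 36X - 30`, `d = 6X - 6`, `ded = 18X - 24`, `e - 4 = 5c - 8`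
  have hD6 : padD c + 6 = 6 * 2 ^ c := by rw [hD]; omega
  have hDed24 : padDed c + 24 = 18 * 2 ^ c := by rw [hDed]; omega
  have hE8 : padE4 c + 8 = 5 * c := by rw [hE4]; omega
  set D := padD c
  set E := padE4 c
  set R := padDed c
  set X := 2 ^ c
  have key : (S + (D * E + R)) + 30 + 24 + D * 8 = D * (5 * c + 1) + 30 + 24 + D * 8 := by
    calc (S + (D * E + R)) + 30 + 24 + D * 8
        = (S + 30) + (R + 24) + D * (E + 8) := by ring
      _ = 36 * X + 18 * X + D * (5 * c) := by rw [htall, hDed24, hE8]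
      _ = 9 * (D + 6) + D * (5 * c) := by rw [hD6]; ring
      _ = D * (5 * c + 1) + 30 + 24 + D * 8 := by ring
  omega

/-- The number of boxes equals `d · m` for the datum `paddedTab`. [folklore] -/
theorem card_boxes_paddedTab {σ : Type*} {c : ℕ} (hc : 2 ≤ c) (x : ℕ → σ) :
    Fintype.card ((n : Fin (paddedTab c hc x).C) × Fin ((paddedTab c hc x).h n)) =
      (paddedTab c hc x).d * (paddedTab c hc x).m := by
  rw [Fintype.card_sigma]
  simp only [Fintype.card_fin]
  change ∑ n : Fin (padC c), padHeight c n = padD c * (5 * c + 1)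
  rw [Fin.sum_univ_eq_sum_range (fun n => padHeight c n) (padC c), sum_padHeight hc]

end

end Summit.ValiantsHypothesis.ValiantsHypothesis.Theorems.GeneratorObstructions.PerGenDegreeSuperQP
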